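import Literature.RepresentationTheory.Semisimple.CommutingAlgebrasSimpleModule
import Mathlib.RingTheory.Flat.FaithfullyFlat.Basic
import HarnessLib

/-!
# A simple module over two commuting algebras is `S ⊗ Hom_A(S, M)` — the SPLIT, infinite-dimensional form
# (Bourbaki *Algèbre* VIII § 7 n° 7 ∕ Bump Prop. 3.4.2 without the dimension count)

Topic `Literature/RepresentationTheory/Semisimple` (namespace `Literature.RepresentationTheory.Semisimple.CommutingAlgebrasSplit`);
THEOREMS ONLY — no definition, no named fact, no instance, no `sorry`.  Sequel of ★ `CommutingAlgebrasSimpleModule` (Bump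
Prop. 3.4.1 ∕ 3.4.2 for `M` FINITE-DIMENSIONAL over an algebraically closed field) and of ★ `IsotypicComponentTensorHom`
(Goodman–Wallach Prop. 4.1.15: `S ⊗ₖ Hom_A(S, M) ≅ M_S` for a SPLIT simple `S`, any `M`).

Setting: `K` any field; `A`, `B` two `K`-algebras acting on `M` with commuting actions (`[SMulCommClass A B M]`); `M` is SIMPLE OVER
THE PAIR (`hirr`: no `A`-submodule stable under `B` other than `⊥`, `⊤` — as in ★ `CommutingAlgebras.range_eval_eq_top`); `S` an
abstract simple `A`-module which is SPLIT (`hS : End_A(S) = K·1`, i.e. `Function.Surjective (algebraMap K (Module.End A S))`) and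
OCCURS in `M` (`j : S →ₗ[A] M`, `j ≠ 0`).  No finite-dimensionality anywhere.  Then:

* §1 `isotypicComponent_eq_top` — `M` is `S`-isotypic: `M_S = M` (the isotypic component is `B`-stable, hence `⊤` by `hirr`);
  `exists_linearEquiv_of_surjective_algebraMap` — **`S ⊗ₖ Hom_A(S, M) ≃ₗ[A] M`**, `s ⊗ φ ↦ φ s`, `B`-equivariant
  (injectivity: Goodman–Wallach, ★ `injective_of_surjective_algebraMap`; surjectivity: §1).
* §2 **`isSimpleModule_hom_of_surjective_algebraMap` — `N := Hom_A(S, M)` is a SIMPLE `B`-module** WITHOUT Bump's dimension count: for a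
  `B`-submodule `N₀` with `λ(S ⊗ N₀) = M`, injectivity of `λ` makes `S ⊗ N₀ → S ⊗ N` ONTO, and a non-zero vector space `S` is faithfully
  flat over `K` (Mathlib `Module.FaithfullyFlat.lTensor_surjective_iff_surjective`), so `N₀ = N`.
* §3 **`exists_linearEquiv_of_hom_equiv` — RIGIDITY**: two modules `M₁`, `M₂`, each simple over the pair `(A, B)` and containing the split
  simple `S`, with `B`-isomorphic multiplicity spaces `Hom_A(S, M₁) ≃ Hom_A(S, M₂)`, are isomorphic as `(A, B)`-modules
  (`M₁ ≅ S ⊗ N₁ ≅ S ⊗ N₂ ≅ M₂`).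

Sources: N. Bourbaki, *Algèbre* VIII (2012), § 7 n° 7 (modules simples sur un produit tensoriel; held `book:bourbaki2012-algebre`);
D. Bump, *Automorphic Forms and Representations* (1997), Prop. 3.4.2 and its use in the proof of Thm. 3.4.4 ∕ §3.4 («every simple
`R = A ⊗ B`-module … has this form `M ⊗ N` for uniquely determined `M` and `N`»; held, PDF pp. 302–305) [Bump1997];
R. Goodman, N. R. Wallach, GTM 255 (2009), Prop. 4.1.15 [GoodmanWallachGTM255].

Consumer (why now): cell hodgecm-mathlib, crux `H413` programme P3, the census of an in-house road for letter F1b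
(`F0/P3/A-p02/CENSUS-F1b-inhouse-road.A-p02g18.md` step R2: `V_P ≅ M ⊗ N_P` for the jointly irreducible `((𝔥,K), U(𝔸_f))`-module of a
discrete automorphic `P`, `M` the irreducible admissible archimedean module with scalar commutant — infinite-dimensional, `K = ℂ`).
-/

namespace Literature.RepresentationTheory.Semisimple.CommutingAlgebrasSplit

open TensorProduct Module
open Literature.RepresentationTheory.Semisimple.IsotypicComponentTensorHom

variable {K : Type*} [Field K] {A : Type*} [Ring A] [Algebra K A] {B : Type*} [Ring B]
  {M : Type*} [AddCommGroup M] [Module K M] [Module A M] [Module B M]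
  [IsScalarTower K A M] [SMulCommClass A B M]
  {S : Type*} [AddCommGroup S] [Module K S] [Module A S] [IsScalarTower K A S] [IsSimpleModule A S]

/-! ### §1 `M` is `S`-isotypic and `S ⊗ₖ Hom_A(S, M) ≅ M` -/

/-- The `B`-action on `M` is by `A`-linear maps, so it preserves the isotypic component `M_S` (a fully invariant `A`-submodule).
[cite: Bump1997, Prop. 3.4.1 proof, PDF p. 302] -/
theorem smul_mem_isotypicComponent (b : B) {w : M} (hw : w ∈ isotypicComponent A M S) : b • w ∈ isotypicComponent A M S := by
  haveI : SMulCommClass B A M := SMulCommClass.symm _ _ _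
  exact Submodule.IsFullyInvariant.isotypicComponent A M S (DistribSMul.toLinearMap A M b) hw

/-- **`M` is `S`-isotypic**: if `M` is simple over the commuting pair `(A, B)` and the simple `A`-module `S` occurs in `M` (`j ≠ 0`), then
`M_S = M`. [cite: Bump1997, Prop. 3.4.1, PDF p. 302] [cite: BourbakiAlgebreVIII2012, VIII §7 n°7] -/
theorem isotypicComponent_eq_top (hirr : ∀ W : Submodule A M, (∀ (b : B) (w : M), w ∈ W → b • w ∈ W) → W = ⊥ ∨ W = ⊤)
    (j : S →ₗ[A] M) (hj : j ≠ 0) : isotypicComponent A M S = ⊤ := by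
  refine (hirr _ fun b _ hw => smul_mem_isotypicComponent b hw).resolve_left fun hbot => hj ?_
  have hle : LinearMap.range j ≤ isotypicComponent A M S := by
    rw [← iSup_range_eq_isotypicComponent]
    exact le_iSup (fun ψ : S →ₗ[A] M => LinearMap.range ψ) j
  rw [hbot, le_bot_iff, LinearMap.range_eq_bot] at hle
  exact hle

/-- **`S ⊗ₖ Hom_A(S, M) ≅ M` for a split simple `S` occurring in a module `M` simple over the commuting pair `(A, B)`** — an `A`-linear
isomorphism `e` with `e (s ⊗ φ) = φ s`, which intertwines `1 ⊗ b` with `b` (no finite-dimensionality, any field; injectivity from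
`End_A(S) = K`, ★ `injective_of_surjective_algebraMap`). [cite: Bump1997, Prop. 3.4.2, PDF pp. 302–303] [cite: BourbakiAlgebreVIII2012, VIII §7 n°7] -/
theorem exists_linearEquiv_of_surjective_algebraMap
    (hirr : ∀ W : Submodule A M, (∀ (b : B) (w : M), w ∈ W → b • w ∈ W) → W = ⊥ ∨ W = ⊤)
    (j : S →ₗ[A] M) (hj : j ≠ 0) (hS : Function.Surjective (algebraMap K (Module.End A S))) :
    ∃ e : S ⊗[K] (S →ₗ[A] M) ≃ₗ[A] M, (∀ (s : S) (φ : S →ₗ[A] M), e (s ⊗ₜ[K] φ) = φ s) ∧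
      ∀ (b : B) (s : S) (φ : S →ₗ[A] M), e (s ⊗ₜ[K] (b • φ)) = b • e (s ⊗ₜ[K] φ) := by
  obtain ⟨α, hα⟩ := exists_eval (k := K) (A := A) (M := M) (S := S)
  have hinj := injective_of_surjective_algebraMap hS α hα
  have hsurj : Function.Surjective α := by
    rw [← LinearMap.range_eq_top, range_eq_isotypicComponent α hα]
    exact isotypicComponent_eq_top hirr j hj
  refine ⟨LinearEquiv.ofBijective α ⟨hinj, hsurj⟩, hα, fun b s φ => ?_⟩
  change α (s ⊗ₜ[K] (b • φ)) = b • α (s ⊗ₜ[K] φ)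
  rw [hα, hα, LinearMap.smul_apply]

/-! ### §2 `Hom_A(S, M)` is a simple `B`-module (no dimension count) -/

omit [IsSimpleModule A S] in
/-- The image `λ(S ⊗ N₀)` of a `B`-submodule `N₀ ⊆ Hom_A(S, M)` is an `A`-submodule of `M` stable under `B`.
[cite: Bump1997, Prop. 3.4.2, PDF pp. 302–303] -/
theorem smul_mem_range_comp_map [Algebra K B] [IsScalarTower K B M] (N₀ : Submodule B (S →ₗ[A] M))
    (α : S ⊗[K] (S →ₗ[A] M) →ₗ[A] M) (hα : ∀ (s : S) (φ : S →ₗ[A] M), α (s ⊗ₜ[K] φ) = φ s) (b : B)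
    {w : M} (hw : w ∈ LinearMap.range (α ∘ₗ
      TensorProduct.AlgebraTensorModule.map LinearMap.id ((N₀.restrictScalars K).subtype))) :
    b • w ∈ LinearMap.range (α ∘ₗ
      TensorProduct.AlgebraTensorModule.map LinearMap.id ((N₀.restrictScalars K).subtype)) := by
  obtain ⟨t, rfl⟩ := hw
  induction t using TensorProduct.induction_on with
  | zero => rw [map_zero, smul_zero]; exact Submodule.zero_mem _
  | tmul s φ =>
    refine ⟨s ⊗ₜ[K] ⟨b • (φ : S →ₗ[A] M), N₀.smul_mem b φ.2⟩, ?_⟩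
    simp only [LinearMap.comp_apply, TensorProduct.AlgebraTensorModule.map_tmul, LinearMap.id_apply,
      Submodule.subtype_apply]
    rw [hα, hα, LinearMap.smul_apply]
  | add x y hx hy => rw [map_add, smul_add]; exact Submodule.add_mem _ hx hy

omit [Module B M] [SMulCommClass A B M] [IsSimpleModule A S] in
/-- The `A`-linear `id ⊗ ι` and the `K`-linear `lTensor S ι` agree as functions. [folklore] -/
private theorem algebraTensorModule_map_id_eq_lTensor {N : Type*} [AddCommGroup N] [Module K N] {N' : Type*} [AddCommGroup N']
    [Module K N'] (g : N →ₗ[K] N') (t : S ⊗[K] N) :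
    TensorProduct.AlgebraTensorModule.map (LinearMap.id : S →ₗ[A] S) g t = LinearMap.lTensor S g t := by
  induction t using TensorProduct.induction_on with
  | zero => rw [map_zero, map_zero]
  | tmul s n => rw [TensorProduct.AlgebraTensorModule.map_tmul, LinearMap.lTensor_tmul, LinearMap.id_apply]
  | add x y hx hy => rw [map_add, map_add, hx, hy]

/-- **`N = Hom_A(S, M)` is a simple `B`-module** for `M` simple over the commuting pair `(A, B)` and `S` a SPLIT simple `A`-module
occurring in `M` — WITHOUT finite-dimensionality (Bump's dimension count replaced by faithful flatness of the non-zero `K`-vector space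
`S`: a `B`-submodule `N₀` with `λ(S ⊗ N₀) = M = λ(S ⊗ N)` and `λ` injective has `S ⊗ N₀ → S ⊗ N` onto, hence `N₀ = N`).
[cite: Bump1997, Prop. 3.4.2, PDF pp. 302–303] [cite: BourbakiAlgebreVIII2012, VIII §7 n°7] -/
theorem isSimpleModule_hom_of_surjective_algebraMap [Algebra K B] [IsScalarTower K B M]
    (hirr : ∀ W : Submodule A M, (∀ (b : B) (w : M), w ∈ W → b • w ∈ W) → W = ⊥ ∨ W = ⊤)
    (j : S →ₗ[A] M) (hj : j ≠ 0) (hS : Function.Surjective (algebraMap K (Module.End A S))) :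
    IsSimpleModule B (S →ₗ[A] M) := by
  obtain ⟨α, hα⟩ := exists_eval (k := K) (A := A) (M := M) (S := S)
  have hinj := injective_of_surjective_algebraMap hS α hα
  haveI hN : Nontrivial (S →ₗ[A] M) := ⟨⟨j, 0, hj⟩⟩
  haveI : Nontrivial (Submodule B (S →ₗ[A] M)) := (Submodule.nontrivial_iff B).2 hN
  haveI : Nontrivial S := IsSimpleModule.nontrivial A S
  refine (isSimpleModule_iff _ _).2 ⟨fun N₀ => ?_⟩
  set γ : S ⊗[K] (N₀.restrictScalars K) →ₗ[A] M :=
    α ∘ₗ TensorProduct.AlgebraTensorModule.map LinearMap.id ((N₀.restrictScalars K).subtype) with hγ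
  have hγt : ∀ (s : S) (φ : N₀.restrictScalars K), γ (s ⊗ₜ[K] φ) = (φ : S →ₗ[A] M) s := by
    intro s φ
    simp only [hγ, LinearMap.comp_apply, TensorProduct.AlgebraTensorModule.map_tmul, LinearMap.id_apply,
      Submodule.subtype_apply, hα]
  rcases hirr (LinearMap.range γ) (fun b w hw => smul_mem_range_comp_map N₀ α hα b hw) with h0 | htop
  · -- every `φ ∈ N₀` vanishes
    left
    refine (Submodule.eq_bot_iff _).2 fun φ hφ => LinearMap.ext fun s => ?_
    have h1 : φ s ∈ LinearMap.range γ := ⟨s ⊗ₜ[K] ⟨φ, hφ⟩, hγt s ⟨φ, hφ⟩⟩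
    rw [h0, Submodule.mem_bot] at h1
    rw [h1, LinearMap.zero_apply]
  · -- `γ` onto `M` and `α` injective ⇒ `S ⊗ N₀ → S ⊗ N` onto ⇒ `N₀ = N` by faithful flatness of `S` over `K`
    right
    have hsurjT : Function.Surjective (LinearMap.lTensor S ((N₀.restrictScalars K).subtype)) := by
      intro x
      have hx : α x ∈ LinearMap.range γ := by rw [htop]; exact Submodule.mem_top
      obtain ⟨t, ht⟩ := hx
      refine ⟨t, hinj ?_⟩
      rw [← algebraTensorModule_map_id_eq_lTensor (A := A) ((N₀.restrictScalars K).subtype) t]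
      exact ht
    have hsurj : Function.Surjective ((N₀.restrictScalars K).subtype) :=
      (Module.FaithfullyFlat.lTensor_surjective_iff_surjective K S ((N₀.restrictScalars K).subtype)).mp hsurjT
    rw [← Submodule.restrictScalars_eq_top_iff K, ← LinearMap.range_eq_top.mpr hsurj, Submodule.range_subtype]

/-! ### §3 Rigidity: the multiplicity space determines `M` -/

/-- **Rigidity**: let `M₁`, `M₂` be simple over the commuting pair `(A, B)`, both containing the split simple `A`-module `S`; if their
multiplicity spaces are isomorphic as `B`-modules (`θ : Hom_A(S, M₁) ≃ Hom_A(S, M₂)`, `K`-linear and `B`-equivariant), then `M₁ ≅ M₂` as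
`(A, B)`-modules (`M₁ ≅ S ⊗ Hom_A(S, M₁) ≅ S ⊗ Hom_A(S, M₂) ≅ M₂`). [cite: Bump1997, Prop. 3.4.2, PDF pp. 302–303 ("uniquely determined")]
[cite: BourbakiAlgebreVIII2012, VIII §7 n°7] -/
theorem exists_linearEquiv_of_hom_equiv {M₂ : Type*} [AddCommGroup M₂] [Module K M₂] [Module A M₂] [Module B M₂]
    [IsScalarTower K A M₂] [SMulCommClass A B M₂]
    (hirr₁ : ∀ W : Submodule A M, (∀ (b : B) (w : M), w ∈ W → b • w ∈ W) → W = ⊥ ∨ W = ⊤)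
    (hirr₂ : ∀ W : Submodule A M₂, (∀ (b : B) (w : M₂), w ∈ W → b • w ∈ W) → W = ⊥ ∨ W = ⊤)
    (j₁ : S →ₗ[A] M) (hj₁ : j₁ ≠ 0) (j₂ : S →ₗ[A] M₂) (hj₂ : j₂ ≠ 0)
    (hS : Function.Surjective (algebraMap K (Module.End A S)))
    (θ : (S →ₗ[A] M) ≃ₗ[K] (S →ₗ[A] M₂)) (hθ : ∀ (b : B) (φ : S →ₗ[A] M), θ (b • φ) = b • θ φ) :
    ∃ e : M ≃ₗ[A] M₂, ∀ (b : B) (m : M), e (b • m) = b • e m := by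
  obtain ⟨e₁, he₁, he₁B⟩ := exists_linearEquiv_of_surjective_algebraMap (B := B) hirr₁ j₁ hj₁ hS
  obtain ⟨e₂, he₂, he₂B⟩ := exists_linearEquiv_of_surjective_algebraMap (B := B) hirr₂ j₂ hj₂ hS
  let c : S ⊗[K] (S →ₗ[A] M) ≃ₗ[A] S ⊗[K] (S →ₗ[A] M₂) :=
    TensorProduct.AlgebraTensorModule.congr (LinearEquiv.refl A S) θ
  refine ⟨(e₁.symm.trans c).trans e₂, fun b m => ?_⟩
  obtain ⟨t, rfl⟩ := e₁.surjective m
  simp only [LinearEquiv.trans_apply, LinearEquiv.symm_apply_apply]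
  -- reduce to pure tensors
  have key : ∀ t : S ⊗[K] (S →ₗ[A] M), e₂ (c (e₁.symm (b • e₁ t))) = b • e₂ (c t) := by
    intro t
    induction t using TensorProduct.induction_on with
    | zero => simp only [map_zero, smul_zero]
    | tmul s φ =>
      rw [← he₁B, LinearEquiv.symm_apply_apply]
      change e₂ (TensorProduct.AlgebraTensorModule.congr (LinearEquiv.refl A S) θ (s ⊗ₜ[K] (b • φ))) =
        b • e₂ (TensorProduct.AlgebraTensorModule.congr (LinearEquiv.refl A S) θ (s ⊗ₜ[K] φ))
      rw [TensorProduct.AlgebraTensorModule.congr_tmul, TensorProduct.AlgebraTensorModule.congr_tmul, LinearEquiv.refl_apply,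
        hθ, he₂B]
    | add x y hx hy =>
      simp only [map_add, smul_add, hx, hy]
  exact key t

end Literature.RepresentationTheory.Semisimple.CommutingAlgebrasSplit
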